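import Summits.CriticalPhenomena.PercolationContinuityZ3.Theorems.FreeBoxPowerSaving.Negative.FreeBoxPowerSavingBounds
import HarnessLib

/-!
# Line `Sketch` (card `l2-gluing-defect-rg`) of crux stmt-CriticalPhenomena-4447 — the transfer stub is a contraction statement

Supports (does not close) the crux `PercNonProliferation.FreeBoxPowerSaving`
(`∃ a C, 0 < a ∧ ∀ n ≥ 1, FA₂(p_c, n) ≤ C n^{-a}`, `FA₂(p, n) = |B(n)|⁻² Σ_{x,y∈B(n)} P_p(x ↔ y inside B(n))`,
bond percolation on `ℤ³`).  Lead `prover-line-stmt-CriticalPhenomena-4447-a1-0`; sorry-free; statements def-free over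
the landed vocabulary `FreeBoxPowerSavingNegative.fa2` (p73056).

The ideator's card closes the crux from A1 (`ContractionImpliesCrux`, landed p121840), A2 (`GlueBlockCriterion`:
`∃ ε₀ > 0, ∀ n ≥ 1, ∀ m, P_{p_c}(GlueAll n m) ≤ 1 - ε₀`, a true same-`p` criterion) and the transfer stub A4
(`StallForcesGlue`: `∀ ε₀ > 0, ∃ ρ < 1, c > 0, n₀, ∀ n ≥ n₀, ρ FA₂(n) ≤ FA₂(3n+1) → P_{p_c}(GlueAll n ⌈c√S(n)⌉) ≥ 1 - ε₀`).
Here, for an ARBITRARY block-event family `G n m` (card: `GlueAll`) and threshold rule `mOf c n` (card: `⌈c √S_{p_c}(n)⌉₊`):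

* `stub_transferIsContraction` — **A2 ⟹ (A4 ⟺ EUC)**, EUC = eventual uniform contraction
  `∃ ρ < 1, ∃ n₀, ∀ n ≥ n₀, FA₂(p_c, 3n+1) ≤ ρ FA₂(p_c, n)` (the hypothesis of A1 verbatim): once its own criterion is
  granted, the line's hard stub says nothing about gluing — it asserts that stalls stop (triage r1-3 "costume of its own
  hypothesis", here in the kernel).  Direction ⟸ holds for every `G` without A2 (`transfer_of_contraction`, vacuously,
  as `FA₂ > 0`).
-/

namespace Summit.CriticalPhenomena.PercolationContinuityZ3.FreeBoxPowerSavingLine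

open MeasureTheory Filter
open Literature.Probability.Percolation Literature.Probability.LatticeModels
open Summit.CriticalPhenomena.PercolationContinuityZ3.FreeBoxPowerSavingNegative
open scoped BigOperators

noncomputable section

namespace TransferIsContraction

/-- `FA₂(p, n) > 0` (the diagonal: `FA₂ ≥ |B(n)|⁻¹`). [folklore] -/
theorem fa2_pos (p : unitInterval) (n : ℕ) : 0 < fa2 p n :=
  (inv_pos.2 (card_box_pos n)).trans_le (inv_card_le_fa2 p n)

/-- **A2 ⟹ (A4 ⟹ EUC)** over `fa2`: run the transfer at `ε₀*/2`; for `n ≥ max n₀ 1` its conclusion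
`1 - ε₀*/2 ≤ P(G n m) ≤ 1 - ε₀*` is impossible, so its premise fails. [folklore] -/
theorem contraction_of_transfer_of_criterion {G : ℕ → ℕ → Set (BondConfig (Site 3))} {mOf : ℝ → ℕ → ℕ}
    (hA2 : ∃ ε₀ : ℝ, 0 < ε₀ ∧ ∀ n m : ℕ, 1 ≤ n →
      (bondPercolation (zdGraph 3) (criticalProbI 3)).real (G n m) ≤ 1 - ε₀)
    (hA4 : ∀ ε₀ : ℝ, 0 < ε₀ → ∃ ρ : ℝ, ρ < 1 ∧ ∃ c : ℝ, 0 < c ∧ ∃ n₀ : ℕ, ∀ n : ℕ, n₀ ≤ n →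
      ρ * fa2 (criticalProbI 3) n ≤ fa2 (criticalProbI 3) (3 * n + 1) →
        1 - ε₀ ≤ (bondPercolation (zdGraph 3) (criticalProbI 3)).real (G n (mOf c n))) :
    ∃ ρ : ℝ, ρ < 1 ∧ ∃ n₀ : ℕ, ∀ n : ℕ, n₀ ≤ n →
      fa2 (criticalProbI 3) (3 * n + 1) ≤ ρ * fa2 (criticalProbI 3) n := by
  obtain ⟨ε, hε, hcrit⟩ := hA2
  obtain ⟨ρ, hρ, c, _hc, n₀, hstall⟩ := hA4 (ε / 2) (by positivity)
  refine ⟨ρ, hρ, max n₀ 1, fun n hn => ?_⟩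
  by_contra hlt
  push Not at hlt
  have hn0 : n₀ ≤ n := le_trans (le_max_left _ _) hn
  have hn1 : 1 ≤ n := le_trans (le_max_right _ _) hn
  have hglue := hstall n hn0 hlt.le
  have hcap := hcrit n (mOf c n) hn1
  linarith

/-- **EUC ⟹ A4** for every block-event family and threshold rule (vacuously: with `ρ₀ = max ρ 0` and
`ρ' = ρ₀ + (1-ρ₀)/2 > ρ₀` the premise `ρ' FA₂(n) ≤ FA₂(3n+1) ≤ ρ₀ FA₂(n)` contradicts `FA₂ > 0`). [folklore] -/
theorem transfer_of_contraction
    (h : ∃ ρ : ℝ, ρ < 1 ∧ ∃ n₀ : ℕ, ∀ n : ℕ, n₀ ≤ n →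
      fa2 (criticalProbI 3) (3 * n + 1) ≤ ρ * fa2 (criticalProbI 3) n)
    (G : ℕ → ℕ → Set (BondConfig (Site 3))) (mOf : ℝ → ℕ → ℕ) :
    ∀ ε₀ : ℝ, 0 < ε₀ → ∃ ρ : ℝ, ρ < 1 ∧ ∃ c : ℝ, 0 < c ∧ ∃ n₀ : ℕ, ∀ n : ℕ, n₀ ≤ n →
      ρ * fa2 (criticalProbI 3) n ≤ fa2 (criticalProbI 3) (3 * n + 1) →
        1 - ε₀ ≤ (bondPercolation (zdGraph 3) (criticalProbI 3)).real (G n (mOf c n)) := by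
  obtain ⟨ρ, hρ, n₀, h⟩ := h
  intro ε₀ _hε₀
  set ρ₀ : ℝ := max ρ 0 with hρ₀
  have hρ₀1 : ρ₀ < 1 := max_lt hρ one_pos
  refine ⟨ρ₀ + (1 - ρ₀) / 2, by linarith, 1, one_pos, n₀, fun n hn hprem => ?_⟩
  exfalso
  have hfa := fa2_pos (criticalProbI 3) n
  have h1 : fa2 (criticalProbI 3) (3 * n + 1) ≤ ρ₀ * fa2 (criticalProbI 3) n :=
    (h n hn).trans (mul_le_mul_of_nonneg_right (le_max_left _ _) hfa.le)
  have h2 : ρ₀ * fa2 (criticalProbI 3) n < (ρ₀ + (1 - ρ₀) / 2) * fa2 (criticalProbI 3) n :=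
    mul_lt_mul_of_pos_right (by linarith) hfa
  linarith

end TransferIsContraction

open TransferIsContraction in
/-- **stub_transferIsContraction (registered on stmt-CriticalPhenomena-4447; line `Sketch`).**  For every block-event
family `G` and threshold rule `mOf`: if the same-`p` criterion `∃ ε₀ > 0, ∀ n ≥ 1, ∀ m, P_{p_c}(G n m) ≤ 1 - ε₀` holds,
then the card's transfer stub (`∀ ε₀ > 0, ∃ ρ < 1, c > 0, n₀, ∀ n ≥ n₀, ρ FA₂(n) ≤ FA₂(3n+1) → P_{p_c}(G n (mOf c n)) ≥ 1 - ε₀`)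
is EQUIVALENT to eventual uniform contraction `∃ ρ < 1, ∃ n₀, ∀ n ≥ n₀, FA₂(p_c,3n+1) ≤ ρ FA₂(p_c,n)`
(`FA₂` spelled out as the free-box pair sum over `|B|²`). [folklore] -/
theorem stub_transferIsContraction :
    ∀ (G : ℕ → ℕ → Set (BondConfig (Site 3))) (mOf : ℝ → ℕ → ℕ),
      (∃ ε₀ : ℝ, 0 < ε₀ ∧ ∀ n m : ℕ, 1 ≤ n →
          (bondPercolation (zdGraph 3) (criticalProbI 3)).real (G n m) ≤ 1 - ε₀) →
      ((∀ ε₀ : ℝ, 0 < ε₀ → ∃ ρ : ℝ, ρ < 1 ∧ ∃ c : ℝ, 0 < c ∧ ∃ n₀ : ℕ, ∀ n : ℕ, n₀ ≤ n →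
          ρ * ((∑ x ∈ box 3 n, ∑ y ∈ box 3 n,
              (bondPercolation (zdGraph 3) (criticalProbI 3)).real
                (openConnIn (↑(box 3 n) : Set (Site 3)) x y)) / ((box 3 n).card : ℝ) ^ 2) ≤
            (∑ x ∈ box 3 (3 * n + 1), ∑ y ∈ box 3 (3 * n + 1),
              (bondPercolation (zdGraph 3) (criticalProbI 3)).real
                (openConnIn (↑(box 3 (3 * n + 1)) : Set (Site 3)) x y)) /
              ((box 3 (3 * n + 1)).card : ℝ) ^ 2 →
          1 - ε₀ ≤ (bondPercolation (zdGraph 3) (criticalProbI 3)).real (G n (mOf c n))) ↔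
        ∃ ρ : ℝ, ρ < 1 ∧ ∃ n₀ : ℕ, ∀ n : ℕ, n₀ ≤ n →
          (∑ x ∈ box 3 (3 * n + 1), ∑ y ∈ box 3 (3 * n + 1),
              (bondPercolation (zdGraph 3) (criticalProbI 3)).real
                (openConnIn (↑(box 3 (3 * n + 1)) : Set (Site 3)) x y)) /
              ((box 3 (3 * n + 1)).card : ℝ) ^ 2 ≤
            ρ * ((∑ x ∈ box 3 n, ∑ y ∈ box 3 n,
              (bondPercolation (zdGraph 3) (criticalProbI 3)).real
                (openConnIn (↑(box 3 n) : Set (Site 3)) x y)) / ((box 3 n).card : ℝ) ^ 2)) :=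
  fun G mOf hA2 => ⟨contraction_of_transfer_of_criterion hA2, fun h => transfer_of_contraction h G mOf⟩

end

end Summit.CriticalPhenomena.PercolationContinuityZ3.FreeBoxPowerSavingLine
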